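import Summits.HubbardSuperconductivity.HubbardSuperconductivity.Theorems.SoloBlindTwistLocalObservables
import Literature.MathematicalPhysics.QuantumLattice.FermionDeterminantBound
import Literature.MathematicalPhysics.QuantumLattice.SectorGroundProjContinuity
import HarnessLib

/-!
# No bounded LOCAL certificate of d-wave order (bootstrap / sum-of-squares duals)

Obstruction report, Theorem 21 (row 18 of the census: semidefinite "many-body bootstrap" /
sum-of-squares certification of ground-state expectation values).

A LOWER-BOUND CERTIFICATE for the order parameter `Δ_dᴴ Δ_d` in the ground states of a sector is
an operator inequality, valid on the unit vectors of the sector,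

  `γ + Σ_{i ∈ J} re ⟨φ, X_i φ⟩ ≤ re ⟨φ, Δ_dᴴ Δ_d φ⟩`        (all unit `φ` of the sector)

with "constraint operators" `X_i` whose ground-state expectations are known to be `≥ 0`; it proves
`⟨ψ, Δ_dᴴ Δ_d ψ⟩ ≥ γ` for every ground state `ψ`. The constraint operators of the bootstrap are
(`perturbative_positivity`, the first-order optimality condition of a ground state):

  `X = Aᴴ [H, A]`,   `re ⟨ψ, Aᴴ (H A - A H) ψ⟩ = ⟨Aψ, (H - E₀) Aψ⟩ ≥ 0`,

together with the eigenstate conditions `⟨ψ, [H, Y] ψ⟩ = 0` and positive squares `Bᴴ B`; in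
practice (and necessarily, for a semidefinite programme of bounded size) the generators `A`, `Y`
are LOCAL: polynomials in `c, c†` of a bounded set of sites. By the graded locality of the Hubbard
interaction (`commutator_hamiltonianWith_mem_carSubalgebra`) such `X` are again local observables,
of range one larger.

THEOREM (`local_certificate_mass`, `bootstrap_certificate_mass`). There are `C(c) > 0` and `L₀(c)`
such that for every `L ≥ L₀`, every normalised sector ground state `ψ` of the Hubbard torus and
every certificate as above whose constraint operators are local, `X_i ∈ 𝔄(S_i)` with `S_i`
contained in `D_i + 1` consecutive `e₁`-columns,

  `(γ - c L⁴) · L ≤ C · Σ_i D_i · |S_i| · ‖X_i‖`.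

So a certificate of d-wave order `γ ≥ 2c L⁴` must have MASS `Σ_i D_i |S_i| ‖X_i‖ ≥ c L⁵ / C`: a
translation-invariant template of bounded range and bounded norm (mass `O(L²)`), and more generally
any family of local certificates of mass `o(L⁵)`, certifies NOTHING about the order parameter for
large `L` — whatever the cost function, the relaxation level, or the solver. The proof is one line
given Theorem 12 (`dWave_order_not_locally_robust`): the twisted competitor `φ` lies in the same
sector, satisfies every local constraint up to `C D |S| ‖X‖ / L`, and has order `< c L⁴`.
This is the precise sense in which requirement R8 of the report (an observable that is both
off-diagonal and of range comparable to `L`) binds the bootstrap: the exact dual certificate exists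
(strong duality in finite dimension) but its generators are as non-local as `Δ_d` itself.

Contents:
* `conjTranspose_mem_carSubalgebra` — `𝔄(S)` is a `*`-subalgebra;
* `perturbative_positivity` — `0 ≤ re ⟨ψ, Aᴴ (HA - AH) ψ⟩` for a sector ground state `ψ` and a
  sector-preserving `A`;
* `commutator_hamiltonianWith_mem_carSubalgebra` — `[H, A] ∈ 𝔄(X')` for `A ∈ 𝔄(X)`, `X'` the
  union of `X` with the supports of the interaction terms meeting `X`;
* `local_certificate_mass` — the mass inequality for arbitrary local constraint operators;
* `bootstrap_certificate_mass` — the same for the bootstrap generators `A_iᴴ [H, A_i]`.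

References (the method whose reach is bounded here): H. Fawzi, O. Fawzi, S. O. Scalet,
"Certified algorithms for equilibrium states of local quantum Hamiltonians", Nat. Commun. 15 (2024)
7394, arXiv:2311.18706; X. Han, "Quantum many-body bootstrap", arXiv:2006.06002; the
"perturbative positivity" / defect bootstrap of arXiv:2511.20860, §2 eq. (2). Locality of the
dynamics generator: O. Bratteli, D. W. Robinson, Operator Algebras and Quantum Statistical
Mechanics II, §6.2.1. Tags: [folklore] for the three lemmas, [this work] for the two theorems.
-/

namespace Summit.HubbardSuperconductivity.HubbardSuperconductivity.Theorems.GaugeTwist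

open Matrix Finset Literature.MathematicalPhysics.QuantumLattice HubbardWave0
  Literature.MathematicalPhysics.QuantumFieldTheory
open scoped ComplexConjugate ComplexOrder Matrix.Norms.L2Operator

-- file-local, as in the sibling `SoloBlind*` files: instance synthesis for
-- `DecidableEq (Orb (FermionTorus 2 L))` must agree with the landed terms.
attribute [-instance] instDecidableEqLex

/-! ### Three lemmas: adjoints, perturbative positivity, locality of `[H, ·]` -/

section Lemmas

variable {ι : Type*} [LinearOrder ι] [Fintype ι]

/-- The CAR subalgebra `𝔄(S)` of a set of orbitals is closed under adjoints (it is the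
`*`-algebra generated by `c_i, c†_i`, `i ∈ S`). Bratteli–Robinson II §5.2.2. [folklore] -/
theorem conjTranspose_mem_carSubalgebra {S : Finset ι} {A : Matrix (Finset ι) (Finset ι) ℂ}
    (hA : A ∈ carSubalgebra S) : Aᴴ ∈ carSubalgebra S := by
  induction hA using Algebra.adjoin_induction with
  | mem M hM =>
    obtain ⟨⟨i, b⟩, hl, rfl⟩ := hM
    rw [conjTranspose_letterOp]
    exact letterOp_mem_carSubalgebra hl
  | algebraMap r =>
    rw [Algebra.algebraMap_eq_smul_one, conjTranspose_smul, conjTranspose_one]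
    exact Subalgebra.smul_mem _ (Subalgebra.one_mem _) _
  | add x y _ _ hx hy => rw [conjTranspose_add]; exact Subalgebra.add_mem _ hx hy
  | mul x y _ _ hx hy => rw [conjTranspose_mul]; exact Subalgebra.mul_mem _ hy hx

omit [LinearOrder ι] in
/-- **Perturbative positivity** (first-order optimality of a ground state): if `H` is Hermitian,
`H ψ = E_K ψ` with `E_K` the lowest energy of `H` on the subspace `K`, and `A ψ ∈ K`, then
`re ⟨ψ, Aᴴ (H A - A H) ψ⟩ = re ⟨Aψ, H Aψ⟩ - E_K ‖Aψ‖² ≥ 0`. This is the family of linear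
constraints of the ground-state bootstrap (arXiv:2006.06002; arXiv:2311.18706; arXiv:2511.20860
eq. (2)). [folklore] -/
theorem perturbative_positivity {H : Matrix ι ι ℂ} (hH : H.IsHermitian)
    (K : Submodule ℂ (ι → ℂ)) {ψ : ι → ℂ} (hHψ : H *ᵥ ψ = ((H.minEnergyOn K : ℝ) : ℂ) • ψ)
    (A : Matrix ι ι ℂ) (hA : A *ᵥ ψ ∈ K) :
    0 ≤ (star ψ ⬝ᵥ ((Aᴴ * (H * A - A * H)) *ᵥ ψ)).re := by
  have key : star ψ ⬝ᵥ ((Aᴴ * (H * A - A * H)) *ᵥ ψ) =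
      star (A *ᵥ ψ) ⬝ᵥ (H *ᵥ (A *ᵥ ψ)) -
        ((H.minEnergyOn K : ℝ) : ℂ) * (star (A *ᵥ ψ) ⬝ᵥ (A *ᵥ ψ)) := by
    rw [← mulVec_mulVec, dotProduct_mulVec, ← star_mulVec, sub_mulVec, ← mulVec_mulVec,
      ← mulVec_mulVec, hHψ, mulVec_smul, dotProduct_sub, dotProduct_smul, smul_eq_mul]
  rw [key, Complex.sub_re, Complex.re_ofReal_mul, sub_nonneg]
  exact minEnergyOn_mul_le_re_rayleigh hH K hA

end Lemmas

section Locality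

variable {Λ : Type*} [LinearOrder Λ] [Fintype Λ] (G : SimpleGraph Λ) [DecidableRel G.Adj]

/-- **Locality of the Heisenberg derivative** (graded locality of the Hubbard interaction): if
`A ∈ 𝔄(X)` and `X' ⊇ X` contains the support of every interaction term meeting `X`, then
`[H(t,U) - μN, A] ∈ 𝔄(X')` — the terms not meeting `X` are even and commute with `A`.
Bratteli–Robinson II §6.2.1. [folklore] -/
theorem commutator_hamiltonianWith_mem_carSubalgebra (t U μ : ℝ) {X X' : Finset Λ}
    (hXX' : X ⊆ X')
    (hsupp : ∀ Z : HubbardIdx G, ¬ Disjoint (hubbardTermSupp G Z) X → hubbardTermSupp G Z ⊆ X')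
    {A : Matrix (Finset (Orb Λ)) (Finset (Orb Λ)) ℂ} (hA : A ∈ carSubalgebra (orbSet X)) :
    hamiltonianWith G t U μ * A - A * hamiltonianWith G t U μ ∈ carSubalgebra (orbSet X') := by
  have hmono : ∀ {Y Y' : Finset Λ}, Y ⊆ Y' →
      carSubalgebra (orbSet Y) ≤ carSubalgebra (ι := Orb Λ) (orbSet Y') :=
    fun h => carSubalgebra_mono fun k hk => mem_orbSet.2 (h (mem_orbSet.1 hk))
  rw [← sum_hubbardTermOp, Finset.sum_mul, Finset.mul_sum, ← Finset.sum_sub_distrib]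
  refine Subalgebra.sum_mem _ fun Z _ => ?_
  by_cases hZ : Disjoint (hubbardTermSupp G Z) X
  · rw [(commute_hubbardTermOp_of_disjoint G t U μ Z hA hZ).eq, sub_self]
    exact Subalgebra.zero_mem _
  · have hT : hubbardTermOp G t U μ Z ∈ carSubalgebra (orbSet X') :=
      hmono (hsupp Z hZ)
        (carEvenSubalgebra_le_carSubalgebra _ (hubbardTermOp_mem_carEvenSubalgebra G t U μ Z))
    have hA' : A ∈ carSubalgebra (orbSet X') := hmono hXX' hA
    exact Subalgebra.sub_mem _ (Subalgebra.mul_mem _ hT hA') (Subalgebra.mul_mem _ hA' hT)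

end Locality

/-! ### The mass of a local certificate -/

/-- **Theorem 21 (no bounded local certificate of d-wave order).** For every `c > 0` there are
`C > 0` and `L₀` such that for all `L = n + 1 ≥ L₀`, every normalised ground state `ψ` of the
Hubbard torus `H = hubbardTorus 2 L t U` in a sector `(N, S^z = Mz)`, every finite family of LOCAL
constraint operators `X_i ∈ 𝔄(S_i)` (`S_i` inside `D_i + 1` consecutive `e₁`-columns) with
`re ⟨ψ, X_i ψ⟩ ≥ 0`, and every `γ`: if the certificate inequality
`γ + Σ_i re ⟨φ, X_i φ⟩ ≤ ⟨Δ_d φ, Δ_d φ⟩` holds for all unit vectors `φ` of the sector, then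

  `(γ - c L⁴) · L ≤ C · Σ_i D_i |S_i| ‖X_i‖`.

(`C = max(16 π M(c), 1)`, `M(c) = ⌊400/c⌋ + 1`, from Theorem 12.) In words: certifying order
`≥ 2c L⁴` by local constraints costs mass `≥ c L⁵ / C`. [this work] -/
theorem local_certificate_mass (t U c : ℝ) (hc : 0 < c) :
    ∃ C : ℝ, 0 < C ∧ ∃ L₀ : ℕ, ∀ n : ℕ, L₀ ≤ n + 1 →
      ∀ {N : ℕ} {Mz : ℝ} {ψ : Fock (Orb (FermionTorus 2 (n + 1)))},
        IsGroundStateInSector (hubbardTorus 2 (n + 1) t U) N Mz ψ → star ψ ⬝ᵥ ψ = 1 →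
        ∀ {κ : Type*} (J : Finset κ) (S : κ → Finset (FermionTorus 2 (n + 1)))
          (x₀ : κ → Site 2 (n + 1)) (D : κ → ℕ)
          (X : κ → Matrix (Finset (Orb (FermionTorus 2 (n + 1))))
            (Finset (Orb (FermionTorus 2 (n + 1)))) ℂ) (γ : ℝ),
          (∀ i ∈ J, ∀ u ∈ S i, ∃ k : ℕ, k ≤ D i ∧ u.toTorusSite 0 = x₀ i 0 + k) →
          (∀ i ∈ J, X i ∈ carSubalgebra (orbSet (S i))) →
          (∀ i ∈ J, 0 ≤ (star ψ ⬝ᵥ (X i *ᵥ ψ)).re) →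
          (∀ φ ∈ szSector N Mz, star φ ⬝ᵥ φ = 1 →
            γ + ∑ i ∈ J, (star φ ⬝ᵥ (X i *ᵥ φ)).re ≤
              (star (pairField dWaveFormFactor (n + 1) *ᵥ φ) ⬝ᵥ
                (pairField dWaveFormFactor (n + 1) *ᵥ φ)).re) →
          (γ - c * ((n : ℝ) + 1) ^ 4) * ((n : ℝ) + 1) ≤
            C * ∑ i ∈ J, (D i : ℝ) * (S i).card * ‖X i‖ := by
  obtain ⟨ε, C, L₀, h12⟩ := dWave_order_not_locally_robust t U c hc
  refine ⟨max C 1, by positivity, L₀, ?_⟩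
  intro n hn N Mz ψ hψ h1 κ J S x₀ D X γ hcol hX hpos hcert
  obtain ⟨φ, hφK, hφ1, -, hord, -, hloc⟩ := h12 n hn hψ h1
  have hL : (0 : ℝ) < (n : ℝ) + 1 := by positivity
  set B : ℝ := max C 1 with hB
  have hCB : C ≤ B := le_max_left _ _
  -- each local constraint is satisfied by the competitor up to `B D |S| ‖X‖ / L`
  have hterm : ∀ i ∈ J,
      (star ψ ⬝ᵥ (X i *ᵥ ψ)).re - B / ((n : ℝ) + 1) * ((D i : ℝ) * (S i).card * ‖X i‖) ≤
        (star φ ⬝ᵥ (X i *ᵥ φ)).re := by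
    intro i hi
    have h := hloc (S i) (x₀ i) (D i) (hcol i hi) (X i) (hX i hi)
    have hnn : (0 : ℝ) ≤ (D i : ℝ) * (S i).card * ‖X i‖ := by positivity
    have h' : ‖star φ ⬝ᵥ (X i *ᵥ φ) - star ψ ⬝ᵥ (X i *ᵥ ψ)‖ ≤
        B / ((n : ℝ) + 1) * ((D i : ℝ) * (S i).card * ‖X i‖) := by
      refine h.trans ?_
      rw [show C * (D i : ℝ) * (S i).card * ‖X i‖ / ((n : ℝ) + 1) =
          C / ((n : ℝ) + 1) * ((D i : ℝ) * (S i).card * ‖X i‖) by ring]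
      gcongr
    have hre := (Complex.abs_re_le_norm _).trans h'
    rw [Complex.sub_re, abs_le] at hre
    linarith [hre.1]
  have hsum := Finset.sum_le_sum hterm
  rw [Finset.sum_sub_distrib, ← Finset.mul_sum] at hsum
  have hposum : 0 ≤ ∑ i ∈ J, (star ψ ⬝ᵥ (X i *ᵥ ψ)).re := Finset.sum_nonneg hpos
  have hc' := hcert φ hφK hφ1
  have key : γ - c * ((n : ℝ) + 1) ^ 4 ≤
      B / ((n : ℝ) + 1) * ∑ i ∈ J, (D i : ℝ) * (S i).card * ‖X i‖ := by linarith
  calc (γ - c * ((n : ℝ) + 1) ^ 4) * ((n : ℝ) + 1)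
      ≤ (B / ((n : ℝ) + 1) * ∑ i ∈ J, (D i : ℝ) * (S i).card * ‖X i‖) * ((n : ℝ) + 1) :=
        mul_le_mul_of_nonneg_right key hL.le
    _ = B * ∑ i ∈ J, (D i : ℝ) * (S i).card * ‖X i‖ := by
        rw [div_mul_eq_mul_div, div_mul_cancel₀ _ hL.ne']

/-- **Theorem 21, bootstrap form.** The same for the generators of the ground-state bootstrap:
local operators `A_i ∈ 𝔄(S_i)` mapping the ground state into its sector, with the constraint
operators `X_i = A_iᴴ (H A_i - A_i H) ∈ 𝔄(S'_i)`, where `S'_i ⊇ S_i` contains the supports of the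
interaction terms meeting `S_i` and lies inside `D_i + 1` consecutive `e₁`-columns. A bootstrap
certificate `γ + Σ_i re ⟨φ, A_iᴴ [H, A_i] φ⟩ ≤ ⟨Δ_d φ, Δ_d φ⟩` (unit `φ` of the sector) then has
`(γ - c L⁴) · L ≤ C · Σ_i D_i |S'_i| ‖A_iᴴ [H, A_i]‖`. [this work] -/
theorem bootstrap_certificate_mass (t U c : ℝ) (hc : 0 < c) :
    ∃ C : ℝ, 0 < C ∧ ∃ L₀ : ℕ, ∀ n : ℕ, L₀ ≤ n + 1 →
      ∀ {N : ℕ} {Mz : ℝ} {ψ : Fock (Orb (FermionTorus 2 (n + 1)))},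
        IsGroundStateInSector (hubbardTorus 2 (n + 1) t U) N Mz ψ → star ψ ⬝ᵥ ψ = 1 →
        ∀ {κ : Type*} (J : Finset κ) (S S' : κ → Finset (FermionTorus 2 (n + 1)))
          (x₀ : κ → Site 2 (n + 1)) (D : κ → ℕ)
          (A : κ → Matrix (Finset (Orb (FermionTorus 2 (n + 1))))
            (Finset (Orb (FermionTorus 2 (n + 1)))) ℂ) (γ : ℝ),
          (∀ i ∈ J, S i ⊆ S' i) →
          (∀ i ∈ J, ∀ Z : HubbardIdx (fermionTorusGraph 2 (n + 1)),
            ¬ Disjoint (hubbardTermSupp (fermionTorusGraph 2 (n + 1)) Z) (S i) →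
              hubbardTermSupp (fermionTorusGraph 2 (n + 1)) Z ⊆ S' i) →
          (∀ i ∈ J, ∀ u ∈ S' i, ∃ k : ℕ, k ≤ D i ∧ u.toTorusSite 0 = x₀ i 0 + k) →
          (∀ i ∈ J, A i ∈ carSubalgebra (orbSet (S i))) →
          (∀ i ∈ J, A i *ᵥ ψ ∈ szSector N Mz) →
          (∀ φ ∈ szSector N Mz, star φ ⬝ᵥ φ = 1 →
            γ + ∑ i ∈ J, (star φ ⬝ᵥ (((A i)ᴴ * (hubbardTorus 2 (n + 1) t U * A i -
                A i * hubbardTorus 2 (n + 1) t U)) *ᵥ φ)).re ≤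
              (star (pairField dWaveFormFactor (n + 1) *ᵥ φ) ⬝ᵥ
                (pairField dWaveFormFactor (n + 1) *ᵥ φ)).re) →
          (γ - c * ((n : ℝ) + 1) ^ 4) * ((n : ℝ) + 1) ≤
            C * ∑ i ∈ J, (D i : ℝ) * (S' i).card *
              ‖(A i)ᴴ * (hubbardTorus 2 (n + 1) t U * A i - A i * hubbardTorus 2 (n + 1) t U)‖ := by
  obtain ⟨C, hC, L₀, h⟩ := local_certificate_mass t U c hc
  refine ⟨C, hC, L₀, ?_⟩
  intro n hn N Mz ψ hψ h1 κ J S S' x₀ D A γ hSS' hsupp hcol hA hAK hcert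
  have hH : hubbardTorus 2 (n + 1) t U = hamiltonianWith (fermionTorusGraph 2 (n + 1)) t U 0 := by
    rw [hamiltonianWith_zero]; rfl
  have hHh : (hubbardTorus 2 (n + 1) t U).IsHermitian :=
    LiebThm1.hamiltonian_isHermitian (fermionTorusGraph 2 (n + 1)) t U
  refine h n hn hψ h1 J S' x₀ D
    (fun i => (A i)ᴴ * (hubbardTorus 2 (n + 1) t U * A i - A i * hubbardTorus 2 (n + 1) t U))
    γ hcol (fun i hi => ?_) (fun i hi => ?_) hcert
  · refine Subalgebra.mul_mem _ ?_ ?_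
    · exact carSubalgebra_mono (fun k hk => mem_orbSet.2 (hSS' i hi (mem_orbSet.1 hk)))
        (conjTranspose_mem_carSubalgebra (hA i hi))
    · rw [hH]
      exact commutator_hamiltonianWith_mem_carSubalgebra _ t U 0 (hSS' i hi) (hsupp i hi) (hA i hi)
  · exact perturbative_positivity hHh (szSector N Mz) hψ.2.2 (A i) (hAK i hi)

end Summit.HubbardSuperconductivity.HubbardSuperconductivity.Theorems.GaugeTwist
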